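import Summits.CriticalPhenomena.PercolationContinuityZ3.Theorems.Transplant.FKConnectivityAllQAntipodalMinorWeightUpc
import HarnessLib

/-!
# Connectivity correlation inequalities for `φ_{w,q}`, every `q > 0` — file 23g: Theorem U with one free edge read by a NESTED PAIR of
# test functions (the aggregation-ready form of "pivot with the root edge free")

Support file (`--supports stmt-CriticalPhenomena-4575`), FK sub-lane `prim-bschramm-fk-2` (gen 24); builds on p205010 (kernel theorem,
internal audit signed; external expert review pending).  No definitions, no named facts, no sorries; standard axioms.

THE OBJECT.  `…AntipodalMinorWeightUpc.lean`: for a two-terminal series–parallel network `E` between `s, t`, `M, C ⊆ E`, every weight `w ≥ 0`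
and every `h` monotone on the subsets of `M`, `0 ≤ apUpcCLW w M C s t h = ∑_{γ ⊆ M} w(k(γ∪C)+k((M\γ)∪C)) (1{s↔t in γ∪C} − 1{s↔t in (M\γ)∪C}) h(γ)`.
THIS FILE fixes a free edge `e` and reads the two halves `{γ ∌ e}` and `{γ ∋ e}` of the cube with TWO test functions `h₀ ≤ h₁` of `γ \ e`:
`0 ≤ ∑_{γ ⊆ M, e ∉ γ} w(·)(c − c̄)(γ) h₀(γ) + ∑_{γ ⊆ M, e ∈ γ} w(·)(c − c̄)(γ) h₁(γ \ e)` for all `h₀, h₁` monotone on the subsets of `M` with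
`h₀ ≤ h₁` pointwise (`FK.apUpcCLW_nested_nonneg_of_isTTSP`; no sign condition on `h₀, h₁`).  Proof: the glued test function
`H(γ) = h₁(γ \ e)` if `e ∈ γ`, `h₀(γ)` otherwise, is monotone exactly because `h₀ ≤ h₁` (`FK.nestedTest_mono`) — an up-set of the cube
`2^M = 2^{M∖e} × {e ∉ ·, e ∈ ·}` is a NESTED PAIR `U₀ ⊆ U₁` of up-sets of `2^{M∖e}`, and a monotone function on it is a pair `h₀ ≤ h₁`.  With
`h₀ = 0 ≤ h₁` this is the favourably polarized Theorem U (`…MinorWeightPolarized.lean`); with `h₀ = h₁` it is Theorem U for a test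
function not reading `e`.  Level forms: `FK.apUpcC_nested_level_nonneg_of_isTTSP`, `FK.apUpcC_nested_levels_le_nonneg_of_isTTSP`.
USE (FK-Q2 §33, memo FROM-fk-2-g24-BLACKBOX §4).  In the three-box normal form of `maj₃` the flips of the special edge `r` of a box `B`
aggregate, by the state of the other two boxes, into Theorem-U functionals of `(B ∪ e) ∖ r` (`e = ab` the root edge of the box, terminals
the ends of `r`) with `e` contracted, deleted, or FREE; in the free case the two halves `e ∈` rich replica / `e ∈` poor replica come with
DIFFERENT monotone coefficient functions `h¹⁰, h⁰¹`, and the present statement is exactly what signs them when `h⁰¹ ≤ h¹⁰` (axiom A3 of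
the black-box theta law in its functional form).
[cite: Grimmett2006, §1.4 eq. (1.20) (p. 15); §3.8 Thm. (3.90) (pp. 61–62)] [cite: Wagner2006, Thm. 5.8(d), §5.3]
-/

noncomputable section

namespace Summit.CriticalPhenomena.PercolationContinuityZ3.Theorems

namespace FK

open SimpleGraph Literature.Probability.LatticeModels Literature.Probability.Percolation
open scoped Classical

variable {V : Type*} [Fintype V]

section Nested

variable {s t : V}

omit [Fintype V] in
/-- **The glued test function of a nested pair is monotone.**  If `h₀, h₁` are monotone on the subsets of `M` and `h₀ ≤ h₁` pointwise,
then `γ ↦ (e ∈ γ ? h₁(γ \ e) : h₀(γ))` is monotone on the subsets of `M`. [folklore] -/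
theorem nestedTest_mono {M : Finset (Sym2 V)} (e : Sym2 V) {h₀ h₁ : Finset (Sym2 V) → ℝ}
    (hle : ∀ ⦃A : Finset (Sym2 V)⦄, A ⊆ M → h₀ A ≤ h₁ A)
    (hmono₀ : ∀ ⦃A B : Finset (Sym2 V)⦄, A ⊆ B → B ⊆ M → h₀ A ≤ h₀ B)
    (hmono₁ : ∀ ⦃A B : Finset (Sym2 V)⦄, A ⊆ B → B ⊆ M → h₁ A ≤ h₁ B) :
    ∀ ⦃A B : Finset (Sym2 V)⦄, A ⊆ B → B ⊆ M →
      (if e ∈ A then h₁ (A.erase e) else h₀ A) ≤ (if e ∈ B then h₁ (B.erase e) else h₀ B) := by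
  intro A B hAB hBM
  have hBe : B.erase e ⊆ M := (Finset.erase_subset e B).trans hBM
  by_cases hA : e ∈ A
  · have hB : e ∈ B := hAB hA
    rw [if_pos hA, if_pos hB]
    exact hmono₁ (Finset.erase_subset_erase e hAB) hBe
  · rw [if_neg hA]
    by_cases hB : e ∈ B
    · rw [if_pos hB]
      have hAB' : A ⊆ B.erase e := fun f hf => Finset.mem_erase.2 ⟨fun h => hA (h ▸ hf), hAB hf⟩
      exact (hmono₀ hAB' hBe).trans (hle hBe)
    · rw [if_neg hB]
      exact hmono₀ hAB hBM

/-- **THEOREM (Theorem U read by a nested pair of test functions; every weight, every cell).**  For a two-terminal series–parallel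
network `E` between `s, t`, `M, C ⊆ E`, an edge `e`, every weight `w ≥ 0` and all `h₀ ≤ h₁` monotone on the subsets of `M`:
`0 ≤ ∑_{γ ⊆ M} w(k(γ∪C)+k((M\γ)∪C)) (1{s↔t in γ∪C} − 1{s↔t in (M\γ)∪C}) · (e ∈ γ ? h₁(γ \ e) : h₀(γ))`.
Proof: `apUpcCLW` against the glued (monotone) test function. [cite: Grimmett2006, §3.8 Thm. (3.90) (pp. 61–62)] [cite: Wagner2006, Thm. 5.8(d), §5.3] -/
theorem apUpcCLW_nested_nonneg_of_isTTSP {E : Finset (Sym2 V)} (hE : IsTTSP E s t) {M C : Finset (Sym2 V)} (hM : M ⊆ E)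
    (hC : C ⊆ E) (e : Sym2 V) {w : ℕ → ℝ} (hw : ∀ n, 0 ≤ w n) {h₀ h₁ : Finset (Sym2 V) → ℝ}
    (hle : ∀ ⦃A : Finset (Sym2 V)⦄, A ⊆ M → h₀ A ≤ h₁ A)
    (hmono₀ : ∀ ⦃A B : Finset (Sym2 V)⦄, A ⊆ B → B ⊆ M → h₀ A ≤ h₀ B)
    (hmono₁ : ∀ ⦃A B : Finset (Sym2 V)⦄, A ⊆ B → B ⊆ M → h₁ A ≤ h₁ B) :
    0 ≤ ∑ γ ∈ M.powerset, w (apExpC M C γ) *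
      ((apConn (γ ∪ C) s t - apConn (M \ γ ∪ C) s t) * (if e ∈ γ then h₁ (γ.erase e) else h₀ γ)) :=
  apUpcCLW_nonneg_of_isTTSP hE M C hM hC w hw (fun γ => if e ∈ γ then h₁ (γ.erase e) else h₀ γ)
    (nestedTest_mono e hle hmono₀ hmono₁)

/-- **The same, as a sum over the two halves of the cube**:
`0 ≤ ∑_{γ ⊆ M, e ∈ γ} w(·)(c − c̄)(γ) h₁(γ \ e) + ∑_{γ ⊆ M, e ∉ γ} w(·)(c − c̄)(γ) h₀(γ)`. [cite: Grimmett2006, §3.8 Thm. (3.90) (pp. 61–62)] -/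
theorem apUpcCLW_nested_split_nonneg_of_isTTSP {E : Finset (Sym2 V)} (hE : IsTTSP E s t) {M C : Finset (Sym2 V)} (hM : M ⊆ E)
    (hC : C ⊆ E) (e : Sym2 V) {w : ℕ → ℝ} (hw : ∀ n, 0 ≤ w n) {h₀ h₁ : Finset (Sym2 V) → ℝ}
    (hle : ∀ ⦃A : Finset (Sym2 V)⦄, A ⊆ M → h₀ A ≤ h₁ A)
    (hmono₀ : ∀ ⦃A B : Finset (Sym2 V)⦄, A ⊆ B → B ⊆ M → h₀ A ≤ h₀ B)
    (hmono₁ : ∀ ⦃A B : Finset (Sym2 V)⦄, A ⊆ B → B ⊆ M → h₁ A ≤ h₁ B) :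
    0 ≤ (∑ γ ∈ M.powerset with e ∈ γ,
        w (apExpC M C γ) * ((apConn (γ ∪ C) s t - apConn (M \ γ ∪ C) s t) * h₁ (γ.erase e))) +
      ∑ γ ∈ M.powerset with e ∉ γ,
        w (apExpC M C γ) * ((apConn (γ ∪ C) s t - apConn (M \ γ ∪ C) s t) * h₀ γ) := by
  have key := apUpcCLW_nested_nonneg_of_isTTSP hE hM hC e hw hle hmono₀ hmono₁
  rw [Finset.sum_filter, Finset.sum_filter, ← Finset.sum_add_distrib]
  refine key.trans_eq (Finset.sum_congr rfl fun γ _ => ?_)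
  by_cases h1 : e ∈ γ <;> simp [h1]

/-- **COROLLARY (nested pair at an exact cluster level).**  With `w = 1_{· = ℓ}`. [cite: Grimmett2006, §3.8 Thm. (3.90) (pp. 61–62)] -/
theorem apUpcC_nested_level_nonneg_of_isTTSP {E : Finset (Sym2 V)} (hE : IsTTSP E s t) {M C : Finset (Sym2 V)} (hM : M ⊆ E)
    (hC : C ⊆ E) (e : Sym2 V) (ℓ : ℕ) {h₀ h₁ : Finset (Sym2 V) → ℝ}
    (hle : ∀ ⦃A : Finset (Sym2 V)⦄, A ⊆ M → h₀ A ≤ h₁ A)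
    (hmono₀ : ∀ ⦃A B : Finset (Sym2 V)⦄, A ⊆ B → B ⊆ M → h₀ A ≤ h₀ B)
    (hmono₁ : ∀ ⦃A B : Finset (Sym2 V)⦄, A ⊆ B → B ⊆ M → h₁ A ≤ h₁ B) :
    0 ≤ ∑ γ ∈ M.powerset with apExpC M C γ = ℓ,
      (apConn (γ ∪ C) s t - apConn (M \ γ ∪ C) s t) * (if e ∈ γ then h₁ (γ.erase e) else h₀ γ) := by
  have key := apUpcCLW_nested_nonneg_of_isTTSP hE hM hC e (w := fun n => if n = ℓ then 1 else 0)
    (fun n => by split_ifs <;> norm_num) hle hmono₀ hmono₁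
  rw [Finset.sum_filter]
  refine key.trans_eq (Finset.sum_congr rfl fun γ _ => ?_)
  simp only [ite_mul, one_mul, zero_mul]

/-- **COROLLARY (nested pair, Abel partial sums).**  With `w = 1_{· ≤ J}`. [cite: Grimmett2006, §3.8 Thm. (3.90) (pp. 61–62)] -/
theorem apUpcC_nested_levels_le_nonneg_of_isTTSP {E : Finset (Sym2 V)} (hE : IsTTSP E s t) {M C : Finset (Sym2 V)} (hM : M ⊆ E)
    (hC : C ⊆ E) (e : Sym2 V) (J : ℕ) {h₀ h₁ : Finset (Sym2 V) → ℝ}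
    (hle : ∀ ⦃A : Finset (Sym2 V)⦄, A ⊆ M → h₀ A ≤ h₁ A)
    (hmono₀ : ∀ ⦃A B : Finset (Sym2 V)⦄, A ⊆ B → B ⊆ M → h₀ A ≤ h₀ B)
    (hmono₁ : ∀ ⦃A B : Finset (Sym2 V)⦄, A ⊆ B → B ⊆ M → h₁ A ≤ h₁ B) :
    0 ≤ ∑ γ ∈ M.powerset with apExpC M C γ ≤ J,
      (apConn (γ ∪ C) s t - apConn (M \ γ ∪ C) s t) * (if e ∈ γ then h₁ (γ.erase e) else h₀ γ) := by
  have key := apUpcCLW_nested_nonneg_of_isTTSP hE hM hC e (w := fun n => if n ≤ J then 1 else 0)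
    (fun n => by split_ifs <;> norm_num) hle hmono₀ hmono₁
  rw [Finset.sum_filter]
  refine key.trans_eq (Finset.sum_congr rfl fun γ _ => ?_)
  simp only [ite_mul, one_mul, zero_mul]

end Nested

end FK

end Summit.CriticalPhenomena.PercolationContinuityZ3.Theorems

end
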